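import Summits.MatrixMultiplication.MatrixMultiplication.Theorems.AbelianSTPPCensusShapeCertVQSearchPS
import Summits.MatrixMultiplication.MatrixMultiplication.Theorems.AbelianSTPPCensusShapeCertVQEvalS457a
import Summits.MatrixMultiplication.MatrixMultiplication.Theorems.AbelianSTPPCensusShapeCertVQEvalS457b

/-!
# Abelian STPP census — the vQ certificate `checkQS` at order 457, assembled from its path segments

Cell mm-stpp, rung F-M1; successor kernel item VQ-CERT in support of the closed crux item stmt-MatrixMultiplication-19191; seat
mm-stpp-vp-p2 (gen 2); support file (no definitions; the only kernel evaluations are block-index bounds `i < #blocks`).  Folds the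
kernel-evaluated path segments of `…AbelianSTPPCensusShapeCertVQEvalS457a…` into `ShapeCertVQ.checkQS 457 = true` with `pathOutS_append` /
`pathInS_append` / `pathOut_single_of_in` / `pathIn_single_of_child` / `pathOK_of_out` / `checkQS_of_pathOK_nil` (`…ShapeCertVQSearchPS`).
WHAT THIS IS NOT: a Boolean fact; no statement about STPP families or `ω` by itself.
-/

set_option linter.dupNamespace false -- `MatrixMultiplication.MatrixMultiplication` (summit = problem, D-0017)
set_option autoImplicit false

namespace Summit.MatrixMultiplication.MatrixMultiplication.Theorems.ShapeCertVQ

/-- the one-block outer segment at node `[(5, 17)]`, block `0`, from its inner segments -/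
theorem pso_457_r_5x17_o0_1 : pathOutS 457 [(5, 17)] 0 1 = true :=
  pathOut_single_of_in (pathInS_append psi_457_r_5x17_b0_0_8 psi_457_r_5x17_b0_8_9999) (by decide +kernel) (by norm_num)

/-- the node `[(5, 17)]` of order `457` is accepted by the search -/
theorem pok_457_r_5x17 : PathOKS 457 [(5, 17)] :=
  pathOK_of_out (pathOutS_append pso_457_r_5x17_o0_1 pso_457_r_5x17_o1_9999) (lt_of_le_of_lt (pathNodeS_blocks_le 457 [(5, 17)]) (by norm_num)) (by norm_num)

/-- the node `[(5, 18)]` of order `457` is accepted by the search -/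
theorem pok_457_r_5x18 : PathOKS 457 [(5, 18)] :=
  pathOK_of_out (pathOutS_append pso_457_r_5x18_o0_1 pso_457_r_5x18_o1_9999) (lt_of_le_of_lt (pathNodeS_blocks_le 457 [(5, 18)]) (by norm_num)) (by norm_num)

/-- one-member inner segment at node `[]`, block `5`, member `17`, from its child node -/
theorem psi_457_r_b5_17_1 : pathInS 457 [] 5 17 1 = true :=
  pathIn_single_of_child psi_457_r_b5_19_9999 pok_457_r_5x17 (by norm_num)

/-- one-member inner segment at node `[]`, block `5`, member `18`, from its child node -/
theorem psi_457_r_b5_18_1 : pathInS 457 [] 5 18 1 = true :=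
  pathIn_single_of_child psi_457_r_b5_19_9999 pok_457_r_5x18 (by norm_num)

/-- the one-block outer segment at node `[]`, block `5`, from its inner segments -/
theorem pso_457_r_o5_1 : pathOutS 457 [] 5 1 = true :=
  pathOut_single_of_in (pathInS_append (pathInS_append (pathInS_append psi_457_r_b5_0_17 psi_457_r_b5_17_1) psi_457_r_b5_18_1) psi_457_r_b5_19_9999) (by decide +kernel) (by norm_num)

/-- the node `[]` of order `457` is accepted by the search -/
theorem pok_457_r : PathOKS 457 [] :=
  pathOK_of_out (pathOutS_append (pathOutS_append pso_457_r_o0_5 pso_457_r_o5_1) pso_457_r_o6_9999) (lt_of_le_of_lt (pathNodeS_blocks_le 457 []) (by norm_num)) (by norm_num)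

/-- **vQ certificate check `checkQS` at order `457`**, assembled from its path segments -/
theorem checkQS_457 : checkQS 457 = true := checkQS_of_pathOK_nil pok_457_r

end Summit.MatrixMultiplication.MatrixMultiplication.Theorems.ShapeCertVQ
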